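import Literature.Geometry.Symplectic.JHolomorphicMap
import Mathlib.Geometry.Manifold.MFDeriv.Basic
import Mathlib.Geometry.Manifold.MFDeriv.FDeriv
import Mathlib.Geometry.Manifold.Instances.Real
import Mathlib.Analysis.Complex.RealDeriv

/-!
# A `JX`-holomorphic function composed with a `J`-holomorphic map is holomorphic
(helper `helper_holCoordCompJHol` of line `cross-cap-laurent`, crux `GromovRecognitionRelEnd`,
item stmt-SmoothPoincare4-11009)

Let `X` be a `C^∞` real `4`-manifold with a family of tangent-space endomorphisms
`JX y : T_y X →L[ℝ] T_y X`, let `T : X → ℂ` be `C^∞` on an open set `O` and `JX`-holomorphic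
there (`dT (JX w) = i · dT w`), and let `u : ℂ → X` be a `C^∞` `J`-holomorphic map
(`du (i ζ) = JX (du ζ)`, `Literature.Geometry.Symplectic.IsJHolomorphic`). Then `T ∘ u` is
complex differentiable on the open set `u ⁻¹' O`.

Proof: at `z` with `u z ∈ O`, `T ∘ u : ℂ → ℂ` has the real Fréchet derivative
`dT_{u z} ∘ du_z` (chain rule `HasMFDerivAt.comp`, then `HasMFDerivAt.hasFDerivAt` for a map of
vector spaces); this real differential commutes with `i` by the two hypotheses, hence is the
restriction of scalars of a complex-linear map (`exists_restrictScalars_eq_of_map_mul_I`), so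
`T ∘ u` is complex differentiable at `z` (`hasFDerivAt_of_restrictScalars`).

References: C. Hummel, *Gromov's Compactness Theorem for Pseudo-holomorphic Curves* (1997),
Ch. I §3 (remark after (3.1): in complex-analytic coordinates `J`-holomorphicity is the
Cauchy–Riemann equations); standard calculus on manifolds (folklore).
No new definitions, notation or instances.
-/

noncomputable section

-- the prescribed namespace `Summit.<P>.<Sub>.…` duplicates `SmoothPoincare4` (P = Sub)
set_option linter.dupNamespace false

open scoped Manifold ContDiff Topology
open Set Function
open Literature.Geometry.Symplectic

namespace Summit.SmoothPoincare4.SmoothPoincare4.Theorems.GromovRecognitionRelEnd.CrossCapLaurent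

/-- **A `JX`-holomorphic function composed with a `J`-holomorphic map is holomorphic.**
If `T : X → ℂ` is `C^∞` on the open set `O` with `dT_y (JX y w) = i · dT_y w` for `y ∈ O`, and
`u : ℂ → X` is a `C^∞` map with `du_z (i ζ) = JX (u z) (du_z ζ)`, then `T ∘ u` is complex
differentiable on `u ⁻¹' O`: its real differential `dT_{u z} ∘ du_z` commutes with `i`, i.e.
satisfies the Cauchy–Riemann equations. [cite: Hummel1997, Ch. I §3 (remark after (3.1))] -/
theorem helper_holCoordCompJHol : ∀ (X : Type) [TopologicalSpace X] [ChartedSpace (EuclideanSpace ℝ (Fin 4)) X] [IsManifold (𝓡 4) ∞ X] (JX : ∀ y : X, TangentSpace (𝓡 4) y →L[ℝ] TangentSpace (𝓡 4) y) (T : X → ℂ) (O : Set X) (u : ℂ → X), IsOpen O → ContMDiffOn (𝓡 4) 𝓘(ℝ, ℂ) ∞ T O → (∀ y ∈ O, ∀ w : TangentSpace (𝓡 4) y, (show ℂ from mfderiv (𝓡 4) 𝓘(ℝ, ℂ) T y (JX y w)) = Complex.I * (show ℂ from mfderiv (𝓡 4) 𝓘(ℝ, ℂ) T y w)) → ContMDiff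 𝓘(ℝ, ℂ) (𝓡 4) ∞ u → Literature.Geometry.Symplectic.IsJHolomorphic (𝓡 4) JX u → DifferentiableOn ℂ (T ∘ u) (u ⁻¹' O) := by
  intro X _ _ _ JX T O u hO hT hTJ hu hJ z hz
  -- `hz : u z ∈ O`; both maps are differentiable at the relevant points
  have hTz : MDifferentiableAt (𝓡 4) 𝓘(ℝ, ℂ) T (u z) :=
    (hT.contMDiffAt (hO.mem_nhds hz)).mdifferentiableAt (by simp)
  have huz : MDifferentiableAt 𝓘(ℝ, ℂ) (𝓡 4) u z := hu.mdifferentiableAt (by simp)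
  -- chain rule, read as a Fréchet derivative of the map `T ∘ u : ℂ → ℂ` of vector spaces
  have hF : HasFDerivAt (T ∘ u)
      ((mfderiv (𝓡 4) 𝓘(ℝ, ℂ) T (u z)).comp (mfderiv 𝓘(ℝ, ℂ) (𝓡 4) u z) : ℂ →L[ℝ] ℂ) z :=
    (hTz.hasMFDerivAt.comp z huz.hasMFDerivAt).hasFDerivAt
  -- the real differential `dT_{u z} ∘ du_z` commutes with `i`, hence is complex linear
  obtain ⟨g, hg⟩ := exists_restrictScalars_eq_of_map_mul_I (F := ℂ)
    ((mfderiv (𝓡 4) 𝓘(ℝ, ℂ) T (u z)).comp (mfderiv 𝓘(ℝ, ℂ) (𝓡 4) u z)) fun ζ => by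
      show (show ℂ from mfderiv (𝓡 4) 𝓘(ℝ, ℂ) T (u z)
          (mfderiv 𝓘(ℝ, ℂ) (𝓡 4) u z (Complex.I * ζ))) =
        Complex.I * (show ℂ from mfderiv (𝓡 4) 𝓘(ℝ, ℂ) T (u z) (mfderiv 𝓘(ℝ, ℂ) (𝓡 4) u z ζ))
      rw [hJ z ζ]
      exact hTJ (u z) hz _
  exact (hasFDerivAt_of_restrictScalars ℝ hF hg).differentiableAt.differentiableWithinAt

end Summit.SmoothPoincare4.SmoothPoincare4.Theorems.GromovRecognitionRelEnd.CrossCapLaurent
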